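import Literature.Combinatorics.Optimization.TracialDesigns
import Literature.Combinatorics.Optimization.MatchingJunta
import HarnessLib

/-!
# Cell pnp-psdrank, route `ChebyshevTracialDesign`: the level classes `Q_c(t)` have uniform marginals

`𝔖ₙ` acts on odd sets and on perfect matchings of `K_n` preserving the crossing number `cc(U,M) = |δ(U) ∩ M|`
(`cc_perm`); it is transitive on perfect matchings (the tree's relative transitivity
`Literature.Combinatorics.Optimization.exists_perm_fix_smul_eq` with `B = ∅`) and on vertex sets of a given size
(`Equiv.extendSubtype`). Hence Rothvoß's LEVEL CLASSES `Q_c(t) = {(U,M) : |U| = t, cc(U,M) = c}`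
[cite: Rothvoss2017, §2 (PDF p. 6)] have UNIFORM MARGINALS: `#{U : |U| = t, cc(U,M) = c}` does not depend on `M`
(`colCount_eq`) and `#{M : cc(U,M) = c}` depends only on `|U|` (`rowCount_eq`); sums of one-sided functions over
`Q_c(t)` factor through the plain sums (`sum_Qset_snd`, `sum_Qset_fst`, `card_Qset_eq_colCount_mul`,
`card_Qset_eq_rowCount_mul`). This is the symmetry input of STEP 0 of every argument about the crux
`TracialDecayExp20` (planner p1, HOME/pnp-psdrank-p1/N2-SpreadStructure.md LINE CPD ¶1: "uniform marginals of
`Q_c`"); consumed by `ChebyshevTracialDesignAPrioriBounds` (profile ≤ trace density; sparse strategies are trivial).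
No definitions are introduced: the counts are written out as `Finset.card` of filters.
WHAT THIS IS NOT: no counting formula for the marginals; nothing on psd rank. Supports crux stmt-PneNP-19878.
-/

set_option linter.dupNamespace false -- `Summit.PneNP.PneNP.…`: summit = sub-problem (D-0017)

noncomputable section

namespace Summit.PneNP.PneNP.Theorems.ChebyshevTracialDesignLevelMarginals

open Finset Literature.Barriers.PneNP Literature.Combinatorics.Optimization
  Literature.Combinatorics.SimpleGraph.CycleSpace

variable {n : ℕ}

/-! ### §1 Relabelling vertices preserves crossing numbers -/

/-- The image of an odd set under a permutation of the vertices is odd. -/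
theorem odd_card_image (π : Equiv.Perm (Fin n)) (U : OddSet n) : Odd (U.1.image π).card := by
  rw [card_image_of_injective _ π.injective]; exact U.2

/-- `π⁻¹(π(U)) = U` as odd sets. -/
theorem image_inv_image_oddSet (π : Equiv.Perm (Fin n)) (U : OddSet n) :
    (⟨(U.1.image π).image ⇑π⁻¹, odd_card_image π⁻¹ ⟨U.1.image π, odd_card_image π U⟩⟩ : OddSet n) = U := by
  apply Subtype.ext
  change (U.1.image π).image ⇑π⁻¹ = U.1
  rw [image_image]
  have : (⇑π⁻¹ ∘ ⇑π) = id := by funext x; simp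
  rw [this, image_id]

/-- `π(π⁻¹(U)) = U` as odd sets. -/
theorem image_image_inv_oddSet (π : Equiv.Perm (Fin n)) (U : OddSet n) :
    (⟨(U.1.image ⇑π⁻¹).image π, odd_card_image π ⟨U.1.image ⇑π⁻¹, odd_card_image π⁻¹ U⟩⟩ : OddSet n) = U := by
  apply Subtype.ext
  change (U.1.image ⇑π⁻¹).image π = U.1
  rw [image_image]
  have : (⇑π ∘ ⇑π⁻¹) = id := by funext x; simp
  rw [this, image_id]

/-- A pair crosses `π(A)` after relabelling iff it crossed `A` before. -/
theorem crosses_image_map_iff (π : Equiv.Perm (Fin n)) (A : Finset (Fin n)) (e : Sym2 (Fin n)) :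
    Crosses (A.image π) (Sym2.map π e) ↔ Crosses A e := by
  have h : ∀ z, π z ∈ A.image π ↔ z ∈ A := fun z => π.injective.mem_finset_image
  induction e using Sym2.ind with
  | _ x y => simp only [Sym2.map_mk, crosses_mk, h]

/-- `π⁻¹ ∘ π = id` on pairs. -/
theorem sym2_map_inv_map (π : Equiv.Perm (Fin n)) (e : Sym2 (Fin n)) : Sym2.map (⇑π⁻¹) (Sym2.map (⇑π) e) = e := by
  rw [Sym2.map_map]
  have : (⇑π⁻¹ ∘ ⇑π) = id := by funext x; simp
  rw [this, Sym2.map_id, id]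

/-- `π ∘ π⁻¹ = id` on pairs. -/
theorem sym2_map_map_inv (π : Equiv.Perm (Fin n)) (e : Sym2 (Fin n)) : Sym2.map (⇑π) (Sym2.map (⇑π⁻¹) e) = e := by
  rw [Sym2.map_map]
  have : (⇑π ∘ ⇑π⁻¹) = id := by funext x; simp
  rw [this, Sym2.map_id, id]

/-- **Relabelling preserves the crossing number**: `cc(π U, π M) = cc(U, M)`. [cite: Rothvoss2017, §2 (PDF p. 5)] -/
theorem cc_perm (π : Equiv.Perm (Fin n)) (U : OddSet n) (M : PMatch n) :
    cc ⟨U.1.image π, odd_card_image π U⟩ (π • M) = cc U M := by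
  classical
  unfold cc
  rw [PMSol.smul_val]
  change (filter (Crosses (U.1.image π)) (M.1.image (Sym2.map π))).card = (filter (Crosses U.1) M.1).card
  symm
  refine card_bij' (fun e _ => Sym2.map π e) (fun e _ => Sym2.map ⇑π⁻¹ e) ?_ ?_ ?_ ?_
  · intro e he
    rw [mem_filter] at he ⊢
    exact ⟨mem_image_of_mem _ he.1, (crosses_image_map_iff π U.1 e).2 he.2⟩
  · intro e he
    rw [mem_filter] at he
    obtain ⟨e', he', rfl⟩ := mem_image.1 he.1
    rw [mem_filter, sym2_map_inv_map]
    exact ⟨he', (crosses_image_map_iff π U.1 e').1 he.2⟩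
  · intro e _
    exact sym2_map_inv_map π e
  · intro e _
    exact sym2_map_map_inv π e

/-! ### §2 Transitivity and uniform marginals of the level classes -/

/-- No pair has all its members in the empty vertex set. -/
theorem innerEdges_empty : innerEdges (∅ : Finset (Fin n)) = ∅ := by
  ext e
  simp only [mem_innerEdges, Finset.notMem_empty, iff_false]
  intro h
  induction e using Sym2.ind with
  | _ x y => exact h x (Sym2.mem_mk_left x y)

/-- `𝔖ₙ` is transitive on the perfect matchings of `K_n` (the tree's relative transitivity with `B = ∅`).
[cite: GodsilMeagher2015, §15.2] -/
theorem exists_perm_smul_eq (M M' : PMatch n) : ∃ π : Equiv.Perm (Fin n), π • M = M' := by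
  obtain ⟨π, -, hπ⟩ := exists_perm_fix_smul_eq (∅ : Finset (Fin n)) M' M
    (by rw [innerEdges_empty, inter_empty, inter_empty])
  exact ⟨π, hπ⟩

/-- `𝔖ₙ` is transitive on vertex sets of a given size. -/
theorem exists_perm_image_eq (A A' : Finset (Fin n)) (h : A.card = A'.card) :
    ∃ π : Equiv.Perm (Fin n), A.image π = A' := by
  have hc : Fintype.card {x // x ∈ A} = Fintype.card {x // x ∈ A'} := by
    rw [Fintype.card_coe, Fintype.card_coe, h]
  let e : {x // x ∈ A} ≃ {x // x ∈ A'} := Fintype.equivOfCardEq hc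
  refine ⟨e.extendSubtype, ?_⟩
  apply eq_of_subset_of_card_le
  · intro y hy
    obtain ⟨x, hx, rfl⟩ := mem_image.1 hy
    exact e.extendSubtype_mem x hx
  · rw [card_image_of_injective _ (Equiv.injective _), h]

/-- The column count `#{U : |U| = t, cc(U,M) = c}` is invariant under relabelling of `M`. -/
theorem colCount_smul (t c : ℕ) (π : Equiv.Perm (Fin n)) (M : PMatch n) :
    (univ.filter fun U : OddSet n => U.1.card = t ∧ cc U (π • M) = c).card =
      (univ.filter fun U : OddSet n => U.1.card = t ∧ cc U M = c).card := by
  refine card_bij' (fun U _ => (⟨U.1.image ⇑π⁻¹, odd_card_image π⁻¹ U⟩ : OddSet n))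
    (fun U _ => (⟨U.1.image π, odd_card_image π U⟩ : OddSet n)) ?_ ?_ ?_ ?_
  · intro U hU
    simp only [mem_filter, mem_univ, true_and] at hU ⊢
    refine ⟨by rw [card_image_of_injective _ (Equiv.injective _)]; exact hU.1, ?_⟩
    have h := cc_perm π⁻¹ U (π • M)
    rw [inv_smul_smul] at h
    rw [h]
    exact hU.2
  · intro U hU
    simp only [mem_filter, mem_univ, true_and] at hU ⊢
    exact ⟨by rw [card_image_of_injective _ (Equiv.injective _)]; exact hU.1, by rw [cc_perm]; exact hU.2⟩
  · intro U _
    exact image_image_inv_oddSet π U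
  · intro U _
    exact image_inv_image_oddSet π U

/-- **Uniform column marginal of the level classes**: `#{U : |U| = t, cc(U,M) = c}` is the same for every perfect
matching `M`. [cite: Rothvoss2017, §2 (PDF p. 6)] -/
theorem colCount_eq (t c : ℕ) (M M' : PMatch n) :
    (univ.filter fun U : OddSet n => U.1.card = t ∧ cc U M = c).card =
      (univ.filter fun U : OddSet n => U.1.card = t ∧ cc U M' = c).card := by
  obtain ⟨π, rfl⟩ := exists_perm_smul_eq M M'
  exact (colCount_smul t c π M).symm

/-- The row count `#{M : cc(U,M) = c}` is invariant under relabelling of `U`. -/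
theorem rowCount_perm (c : ℕ) (π : Equiv.Perm (Fin n)) (U : OddSet n) :
    (univ.filter fun M : PMatch n => cc ⟨U.1.image π, odd_card_image π U⟩ M = c).card =
      (univ.filter fun M : PMatch n => cc U M = c).card := by
  symm
  refine card_bij' (fun M _ => π • M) (fun M _ => π⁻¹ • M) ?_ ?_ ?_ ?_
  · intro M hM
    simp only [mem_filter, mem_univ, true_and] at hM ⊢
    rw [cc_perm]
    exact hM
  · intro M hM
    simp only [mem_filter, mem_univ, true_and] at hM ⊢
    have h := cc_perm π U (π⁻¹ • M)
    rw [smul_inv_smul] at h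
    rw [← h]
    exact hM
  · intro M _
    exact inv_smul_smul π M
  · intro M _
    exact smul_inv_smul π M

/-- **Uniform row marginal of the level classes**: `#{M : cc(U,M) = c}` depends only on `|U|`.
[cite: Rothvoss2017, §2 (PDF p. 6)] -/
theorem rowCount_eq (c : ℕ) (U U' : OddSet n) (h : U.1.card = U'.1.card) :
    (univ.filter fun M : PMatch n => cc U M = c).card = (univ.filter fun M : PMatch n => cc U' M = c).card := by
  obtain ⟨π, hπ⟩ := exists_perm_image_eq U.1 U'.1 h
  have : (⟨U.1.image π, odd_card_image π U⟩ : OddSet n) = U' := Subtype.ext hπ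
  rw [← this, rowCount_perm]

/-- **Column sums over a level class factor**: `Σ_{(U,M) ∈ Q_c(t)} g(M) = #{U : |U| = t, cc(U,M₀) = c} · Σ_M g(M)` for
any reference matching `M₀`. [cite: Rothvoss2017, §2 (PDF p. 6)] -/
theorem sum_Qset_snd (t c : ℕ) (g : PMatch n → ℝ) (M₀ : PMatch n) :
    ∑ q ∈ Qset n t c, g q.2 =
      ((univ.filter fun U : OddSet n => U.1.card = t ∧ cc U M₀ = c).card : ℝ) * ∑ M, g M := by
  classical
  calc ∑ q ∈ Qset n t c, g q.2
      = ∑ p : OddSet n × PMatch n, (if p.1.1.card = t ∧ cc p.1 p.2 = c then g p.2 else 0) := by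
        rw [Qset, sum_filter]
    _ = ∑ M : PMatch n, ∑ U : OddSet n, (if U.1.card = t ∧ cc U M = c then g M else 0) := by
        rw [← univ_product_univ, sum_product_right]
    _ = ∑ M : PMatch n, ((univ.filter fun U : OddSet n => U.1.card = t ∧ cc U M = c).card : ℝ) * g M := by
        refine sum_congr rfl fun M _ => ?_
        rw [← sum_filter, sum_const, nsmul_eq_mul]
    _ = ((univ.filter fun U : OddSet n => U.1.card = t ∧ cc U M₀ = c).card : ℝ) * ∑ M, g M := by
        rw [mul_sum]
        exact sum_congr rfl fun M _ => by rw [colCount_eq t c M M₀]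

/-- `|Q_c(t)| = #{U : |U| = t, cc(U,M₀) = c} · #(perfect matchings)`. [cite: Rothvoss2017, §2 (PDF p. 6)] -/
theorem card_Qset_eq_colCount_mul (t c : ℕ) (M₀ : PMatch n) :
    ((Qset n t c).card : ℝ) =
      ((univ.filter fun U : OddSet n => U.1.card = t ∧ cc U M₀ = c).card : ℝ) * Fintype.card (PMatch n) := by
  have h := sum_Qset_snd t c (fun _ => (1 : ℝ)) M₀
  simpa [sum_const, card_univ] using h

/-- **Row sums over a level class factor**: `Σ_{(U,M) ∈ Q_c(t)} f(U) = #{M : cc(U₀,M) = c} · Σ_{|U| = t} f(U)` for any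
reference `t`-cut `U₀`. [cite: Rothvoss2017, §2 (PDF p. 6)] -/
theorem sum_Qset_fst (t c : ℕ) (f : OddSet n → ℝ) (U₀ : OddSet n) (hU₀ : U₀.1.card = t) :
    ∑ q ∈ Qset n t c, f q.1 =
      ((univ.filter fun M : PMatch n => cc U₀ M = c).card : ℝ) *
        ∑ U ∈ univ.filter (fun U : OddSet n => U.1.card = t), f U := by
  classical
  calc ∑ q ∈ Qset n t c, f q.1
      = ∑ p : OddSet n × PMatch n, (if p.1.1.card = t ∧ cc p.1 p.2 = c then f p.1 else 0) := by
        rw [Qset, sum_filter]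
    _ = ∑ U : OddSet n, ∑ M : PMatch n, (if U.1.card = t ∧ cc U M = c then f U else 0) := by
        rw [← univ_product_univ, sum_product]
    _ = ∑ U : OddSet n, (if U.1.card = t then
          ((univ.filter fun M : PMatch n => cc U M = c).card : ℝ) * f U else 0) := by
        refine sum_congr rfl fun U _ => ?_
        by_cases hU : U.1.card = t
        · simp only [hU, true_and, if_true]
          rw [← sum_filter, sum_const, nsmul_eq_mul]
        · simp [hU]
    _ = ∑ U ∈ univ.filter (fun U : OddSet n => U.1.card = t),
          ((univ.filter fun M : PMatch n => cc U M = c).card : ℝ) * f U := by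
        rw [sum_filter]
    _ = ((univ.filter fun M : PMatch n => cc U₀ M = c).card : ℝ) *
          ∑ U ∈ univ.filter (fun U : OddSet n => U.1.card = t), f U := by
        rw [mul_sum]
        refine sum_congr rfl fun U hU => ?_
        rw [rowCount_eq c U U₀ ((mem_filter.1 hU).2.trans hU₀.symm)]

/-- `|Q_c(t)| = #{M : cc(U₀,M) = c} · #(t-cuts)`. [cite: Rothvoss2017, §2 (PDF p. 6)] -/
theorem card_Qset_eq_rowCount_mul (t c : ℕ) (U₀ : OddSet n) (hU₀ : U₀.1.card = t) :
    ((Qset n t c).card : ℝ) =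
      ((univ.filter fun M : PMatch n => cc U₀ M = c).card : ℝ) *
        (univ.filter (fun U : OddSet n => U.1.card = t)).card := by
  have h := sum_Qset_fst t c (fun _ => (1 : ℝ)) U₀ hU₀
  simpa [sum_const] using h

end Summit.PneNP.PneNP.Theorems.ChebyshevTracialDesignLevelMarginals

end
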